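import Summits.QuantumFields.YangMills.Theorems.SwapVirialDeficitBlowUpGnomonicBFibreJets
import Summits.QuantumFields.YangMills.Theorems.SwapVirialDeficitBlowUpGnoDensityAmplitude
import Mathlib.Analysis.SpecialFunctions.JapaneseBracket
import HarnessLib

/-!
# STUB (S-B) OF SKELETON ➎, SOCKETS part 2a: THE `√(1+|u|²)`-RESCALED `x₀`-LETTER OF THE B-FIBRE — uniform coercivity on `{|u| ≥ τ}` and the amplitude
# (free-hands support of ⟨stmt-QuantumFields-24197⟩ `SwapVirialDeficit.SwapGluedStiffness` ∕ ⟨24194⟩; cell ym-idea-1, LEAD memo7 §E(3), w3 g66 19:57Z ∕ LEAD g99 20:01Z: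
# «no cap on |u|; rescale x₀ ↦ √(1+|u|²)·x₀′»; the B-twin of ✓`…BlowUpGnomonicFibreRescaled` ∕ `…FibreRescaledFloors`)

Over the stratum-B base `u = x_⊥ ∈ ℝ²` the gnomonic chart degenerates as `|u| → ∞` (the equator of the leader sphere): w3's joint-diagonal floor
✓`fibre_raySecond_ge_stratumB_joint_diag` has `x₀′`-coefficient `|u|²∕(12375L⁶(1+|u|²)²) → 0`.  In the rescaled letter `x₀ = √(1+|u|²)·x₀′` every coefficient is
`≳ |u|²∕(1+|u|²) ≥ τ²∕(1+τ²)` and the base weight becomes `(1+|u|²)^{−3∕2}`, integrable on `ℝ²`.  This file: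
* §1 `gnoFibreBScale u` (`√(1+|u|²)` on the `x₀` letter, `1` elsewhere), `gnoScaleB u y`, `gnoScaleBLin u` (+ positivity, measurability, `prod_gnoFibreBScale = √(1+|u|²)`,
  symmetry); §2 the letters of the rescaled chart point `gnoFibreBEquiv (u, gnoScaleB u y)` and of the direction `gnoFibreBEmb (gnoScaleB u y)`, `norm_sq_gnoFibreB_letters`;
* §4 the amplitude: `gnomonicWeight_bRescaled` (`w(√(1+|u|²)x₀, u₁, u₂) = w(0,u₁,u₂)·w(x₀,0,0)`), ★ `bDensity_rescaled_eq`
  (`J_B(Ψ_B(u, gnoScaleB u y)) = w(0,u₁,u₂)·g(y)`, `g(y) = ((1+y_δ²)⁻¹)²·ρ((gnoFibreBEmb y).2)` INDEPENDENT of `u`), `bFibreWeight_bounds` (`1 − 2‖y‖² ≤ g(y) ≤ 1`),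
  ★ `bBaseWeight_facts` (`w₀(u) = w(0,u₁,u₂)·√(1+|u|²) = (1+|u|²)^{−3∕2}` positive, measurable, INTEGRABLE on `ℝ²` — Mathlib ✓`integrable_rpow_neg_one_add_norm_sq`).

What is NOT here: §3 the uniform coercivity `bFibQ_gnoScaleB_ge` (next file `…BFibreRescaledFloor`, w3's ✓`fibre_raySecond_ge_stratumB_joint_diag` in the rescaled letter);
part 2b (needs g47's K7e `taylor_four_gnoDeficit_hubLine_B` with the `x₀`-size normalised by `√(1+|u|²)`): the rescaled cubic datum, the scaled tube chart identity,
the packaged sockets, the far floor.  HONEST LABEL: (S-B), (S-core), (S-001), ⟨24197⟩ ∕ ⟨24194⟩ OPEN; own crux ⟨22884⟩ OPEN (blocked-on ⟨19935⟩); the Yang–Mills mass gap is NOT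
proved; no summit is proved by a line.  Definitions + theorems (0 `sorry`), standard axioms.  Width seat ym-line-sfw-p2-w2 g59 (cell ym-idea-1, free hands),
`--supports stmt-QuantumFields-24197`.  References: [cite: Luscher1983, §2]; [folklore].
-/

set_option autoImplicit false
set_option synthInstance.maxSize 1024

noncomputable section

open MeasureTheory Quaternion Set Metric
open scoped BigOperators Quaternion InnerProductSpace ENNReal
open Literature.MathematicalPhysics.QuantumFieldTheory hiding SU2
open Literature.MathematicalPhysics.QuantumLattice

namespace Summit.QuantumFields.YangMills.Theorems.SwapVirialDeficit.BlowUpRing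

open Summit.QuantumFields.YangMills.Theorems.FemtoTransferGap
open Summit.QuantumFields.YangMills.Theorems.FemtoTransferGap.TT
open Summit.QuantumFields.YangMills.Theorems.VirialFluxGap.RingDeficit
open Summit.QuantumFields.YangMills.Theorems.SwapVirialDeficit.SwapRing
open Summit.QuantumFields.YangMills.Theorems.SwapVirialDeficit.Gnomonic (normSq3 normSq3_nonneg gnomonicWeight gnomonicWeight_pos gnomonicWeight_le_one piWeight piWeight_pos
  piWeight_le_one)

variable {L : ℕ} [NeZero L]

/-! ## §1 The weight and the rescaled B-fibre vector -/

/-- THE B-RESCALING WEIGHT over the base `u = (u₁, u₂)`: `√(1+|u|²)` on the `x₀` letter (index `inl (inl 1)`), `1` on `δ`, `y₀`, `y_⊥`, `z` and the followers. [folklore] -/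
def gnoFibreBScale (u : ℝ × ℝ) : GnoFibreBIdx L → ℝ :=
  Sum.elim (Sum.elim (![1, Real.sqrt (1 + (u.1 ^ 2 + u.2 ^ 2)), 1] : Fin 3 → ℝ) (fun _ : Fin 2 => (1 : ℝ)))
    (Sum.elim (fun _ : Fin 3 => (1 : ℝ)) (fun _ : Fol L × Fin 3 => (1 : ℝ)))

/-- THE RESCALED B-FIBRE VECTOR `gnoScaleB u y = (gnoFibreBScale u i · y_i)_i`. [folklore] -/
def gnoScaleB (u : ℝ × ℝ) (y : GnoFibreB L) : GnoFibreB L := WithLp.toLp 2 fun i => gnoFibreBScale (L := L) u i * y i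

/-- The B-rescaling as a linear map of the B-fibre. [folklore] -/
def gnoScaleBLin (u : ℝ × ℝ) : GnoFibreB L →ₗ[ℝ] GnoFibreB L where
  toFun := gnoScaleB u
  map_add' y y' := PiLp.ext fun i => by simp only [gnoScaleB, PiLp.toLp_apply, PiLp.add_apply]; ring
  map_smul' c y := PiLp.ext fun i => by simp only [gnoScaleB, PiLp.toLp_apply, PiLp.smul_apply, smul_eq_mul, RingHom.id_apply]; ring

omit [NeZero L] in
/-- The weights, index by index. [folklore] -/
theorem gnoFibreBScale_apply (u : ℝ × ℝ) :
    gnoFibreBScale (L := L) u (Sum.inl (Sum.inl 0)) = 1 ∧ gnoFibreBScale (L := L) u (Sum.inl (Sum.inl 1)) = Real.sqrt (1 + (u.1 ^ 2 + u.2 ^ 2)) ∧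
      gnoFibreBScale (L := L) u (Sum.inl (Sum.inl 2)) = 1 ∧ (∀ j, gnoFibreBScale (L := L) u (Sum.inl (Sum.inr j)) = 1) ∧
      (∀ k, gnoFibreBScale (L := L) u (Sum.inr (Sum.inl k)) = 1) ∧ ∀ fk, gnoFibreBScale (L := L) u (Sum.inr (Sum.inr fk)) = 1 := by
  refine ⟨rfl, rfl, rfl, fun j => rfl, fun k => rfl, fun fk => rfl⟩

omit [NeZero L] in
/-- Every weight is positive. [folklore] -/
theorem gnoFibreBScale_pos (u : ℝ × ℝ) (i : GnoFibreBIdx L) : 0 < gnoFibreBScale (L := L) u i := by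
  obtain ⟨h0, h1, h2, hj, hk, hf⟩ := gnoFibreBScale_apply (L := L) u
  rcases i with ((j | j) | (k | fk))
  · fin_cases j
    · exact h0 ▸ one_pos
    · exact h1 ▸ Real.sqrt_pos.2 (by positivity)
    · exact h2 ▸ one_pos
  · exact (hj j) ▸ one_pos
  · exact (hk k) ▸ one_pos
  · exact (hf fk) ▸ one_pos

omit [NeZero L] in
/-- Every weight is `≥ 1`. [folklore] -/
theorem one_le_gnoFibreBScale (u : ℝ × ℝ) (i : GnoFibreBIdx L) : 1 ≤ gnoFibreBScale (L := L) u i := by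
  obtain ⟨h0, h1, h2, hj, hk, hf⟩ := gnoFibreBScale_apply (L := L) u
  rcases i with ((j | j) | (k | fk))
  · fin_cases j
    · exact h0 ▸ le_rfl
    · exact Real.one_le_sqrt.2 (by nlinarith [sq_nonneg u.1, sq_nonneg u.2])
    · exact h2 ▸ le_rfl
  · exact (hj j) ▸ le_rfl
  · exact (hk k) ▸ le_rfl
  · exact (hf fk) ▸ le_rfl

omit [NeZero L] in
/-- Coordinates of the rescaled vector. [folklore] -/
theorem gnoScaleB_apply (u : ℝ × ℝ) (y : GnoFibreB L) (i : GnoFibreBIdx L) : gnoScaleB u y i = gnoFibreBScale (L := L) u i * y i := rfl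

omit [NeZero L] in
/-- The rescaling commutes with scalars. [folklore] -/
theorem gnoScaleB_smul (u : ℝ × ℝ) (t : ℝ) (y : GnoFibreB L) : gnoScaleB u (t • y) = t • gnoScaleB u y :=
  PiLp.ext fun i => by simp only [gnoScaleB, PiLp.toLp_apply, PiLp.smul_apply, smul_eq_mul]; ring

omit [NeZero L] in
/-- The linear map is the rescaling. [folklore] -/
theorem gnoScaleBLin_apply (u : ℝ × ℝ) (y : GnoFibreB L) : gnoScaleBLin u y = gnoScaleB u y := rfl

omit [NeZero L] in
/-- The weights are measurable in the base point. [folklore] -/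
theorem measurable_gnoFibreBScale (i : GnoFibreBIdx L) : Measurable fun u : ℝ × ℝ => gnoFibreBScale (L := L) u i := by
  have hc : Measurable fun u : ℝ × ℝ => Real.sqrt (1 + (u.1 ^ 2 + u.2 ^ 2)) :=
    (measurable_const.add ((measurable_fst.pow_const 2).add (measurable_snd.pow_const 2))).sqrt
  rcases i with ((j | j) | (k | fk))
  · fin_cases j
    · exact measurable_const
    · exact hc
    · exact measurable_const
  · exact measurable_const
  · exact measurable_const
  · exact measurable_const

omit [NeZero L] in
/-- `(u, y) ↦ gnoScaleB u y` is jointly measurable. [folklore] -/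
theorem measurable_gnoScaleB_prod : Measurable fun q : (ℝ × ℝ) × GnoFibreB L => gnoScaleB (L := L) q.1 q.2 := by
  refine (WithLp.measurable_toLp 2 _).comp (measurable_pi_lambda _ fun i => ?_)
  exact ((measurable_gnoFibreBScale i).comp measurable_fst).mul ((measurable_pi_apply i).comp ((WithLp.measurable_ofLp 2 _).comp measurable_snd))

/-- ★ The Jacobian of the rescaling: `Π_i gnoFibreBScale u i = √(1+|u|²)`. [folklore] -/
theorem prod_gnoFibreBScale (u : ℝ × ℝ) : ∏ i, gnoFibreBScale (L := L) u i = Real.sqrt (1 + (u.1 ^ 2 + u.2 ^ 2)) := by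
  rw [Fintype.prod_sum_type, Fintype.prod_sum_type, Fintype.prod_sum_type, Fin.prod_univ_three]
  simp [gnoFibreBScale]

/-- `Π_i |gnoFibreBScale u i| = √(1+|u|²)`. [folklore] -/
theorem prod_abs_gnoFibreBScale (u : ℝ × ℝ) : ∏ i, |gnoFibreBScale (L := L) u i| = Real.sqrt (1 + (u.1 ^ 2 + u.2 ^ 2)) := by
  rw [← prod_gnoFibreBScale (L := L) u]
  exact Finset.prod_congr rfl fun i _ => abs_of_pos (gnoFibreBScale_pos u i)

/-- The rescaling is a symmetric operator (diagonal in an orthonormal basis). [folklore] -/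
theorem gnoScaleBLin_isSymmetric (u : ℝ × ℝ) : (gnoScaleBLin (L := L) u).IsSymmetric := by
  intro y w
  simp only [gnoScaleBLin_apply, PiLp.inner_apply, gnoScaleB_apply, RCLike.inner_apply, conj_trivial]
  exact Finset.sum_congr rfl fun i _ => by ring

/-- `‖gnoScaleB u y‖ ≥ ‖y‖` (all weights `≥ 1`) — so the rescaled far region contains the plain one. [folklore] -/
theorem norm_le_norm_gnoScaleB (u : ℝ × ℝ) (y : GnoFibreB L) : ‖y‖ ≤ ‖gnoScaleB u y‖ := by
  have h : ‖y‖ ^ 2 ≤ ‖gnoScaleB u y‖ ^ 2 := by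
    rw [EuclideanSpace.real_norm_sq_eq, EuclideanSpace.real_norm_sq_eq]
    refine Finset.sum_le_sum fun i _ => ?_
    rw [gnoScaleB_apply, mul_pow]
    have h1 : 1 ≤ gnoFibreBScale (L := L) u i ^ 2 := one_le_pow₀ (one_le_gnoFibreBScale u i)
    nlinarith [sq_nonneg (y i)]
  exact (pow_le_pow_iff_left₀ (norm_nonneg _) (norm_nonneg _) two_ne_zero).1 h

/-! ## §2 The letters of the rescaled chart point and of the rescaled direction -/

/-- The rescaled direction in `ℝ × GnoCoord L`: `gnoFibreBEmb (gnoScaleB u y) = (y_δ, ((√(1+|u|²)x₀, 0, 0), (y₀, v₀, v₁)), z, η_F)`. [folklore] -/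
theorem gnoFibreBEmb_gnoScaleB (u : ℝ × ℝ) (y : GnoFibreB L) :
    gnoFibreBEmb (gnoScaleB u y) = (y (Sum.inl (Sum.inl 0)),
      ((((![Real.sqrt (1 + (u.1 ^ 2 + u.2 ^ 2)) * y (Sum.inl (Sum.inl 1)), 0, 0] : Fin 3 → ℝ),
          (![y (Sum.inl (Sum.inl 2)), y (Sum.inl (Sum.inr 0)), y (Sum.inl (Sum.inr 1))] : Fin 3 → ℝ)),
        ((fun k => y (Sum.inr (Sum.inl k))), (fun f k => y (Sum.inr (Sum.inr (f, k)))))) : GnoCoord L)) := by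
  rw [gnoFibreBEmb_apply]
  simp only [gnoScaleB_apply, gnoFibreBScale, Sum.elim_inl, Sum.elim_inr, Matrix.cons_val_zero, Matrix.cons_val_one, Matrix.cons_val_two,
    Matrix.head_cons, Matrix.tail_cons, one_mul]

/-- The rescaled chart point: `gnoFibreBEquiv (u, gnoScaleB u y) = (y_δ, ((√(1+|u|²)x₀, u₁, u₂), (y₀, v₀, v₁)), z, η_F)`. [folklore] -/
theorem gnoFibreBEquiv_gnoScaleB (u : ℝ × ℝ) (y : GnoFibreB L) :
    gnoFibreBEquiv (u, gnoScaleB u y) = (y (Sum.inl (Sum.inl 0)),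
      ((((![Real.sqrt (1 + (u.1 ^ 2 + u.2 ^ 2)) * y (Sum.inl (Sum.inl 1)), u.1, u.2] : Fin 3 → ℝ),
          (![y (Sum.inl (Sum.inl 2)), y (Sum.inl (Sum.inr 0)), y (Sum.inl (Sum.inr 1))] : Fin 3 → ℝ)),
        ((fun k => y (Sum.inr (Sum.inl k))), (fun f k => y (Sum.inr (Sum.inr (f, k)))))) : GnoCoord L)) := by
  rw [gnoFibreBEquiv_apply']
  simp only [gnoScaleB_apply, gnoFibreBScale, Sum.elim_inl, Sum.elim_inr, Matrix.cons_val_zero, Matrix.cons_val_one, Matrix.cons_val_two,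
    Matrix.head_cons, Matrix.tail_cons, one_mul]

/-- ★ **THE GAUGE IDENTITY IN LETTERS**: `‖y‖² = y_δ² + x₀² + (y₀² + v₀² + v₁²) + |z|² + Σ_f |η_f|²`. [folklore] -/
theorem norm_sq_gnoFibreB_letters (y : GnoFibreB L) :
    ‖y‖ ^ 2 = y (Sum.inl (Sum.inl 0)) ^ 2 + y (Sum.inl (Sum.inl 1)) ^ 2 +
      (y (Sum.inl (Sum.inl 2)) ^ 2 + (y (Sum.inl (Sum.inr 0)) ^ 2 + y (Sum.inl (Sum.inr 1)) ^ 2)) +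
      normSq3 (fun k => y (Sum.inr (Sum.inl k))) + ∑ f, normSq3 (fun k => y (Sum.inr (Sum.inr (f, k)))) := by
  rw [norm_sq_gnoFibreB]
  simp only [gnoFibreBBlocks, normSq3, Fin.sum_univ_three]
  ring

/-! ## §4 The amplitude in the rescaled letters -/

omit [NeZero L] in
/-- `w(√(1+|u|²)·x₀, u₁, u₂) = w(0, u₁, u₂)·w(x₀, 0, 0)`: in the rescaled letter the leader weight FACTORISES into base and fibre parts. [folklore] -/
theorem gnomonicWeight_bRescaled (x₀ u₁ u₂ : ℝ) :
    gnomonicWeight (![Real.sqrt (1 + (u₁ ^ 2 + u₂ ^ 2)) * x₀, u₁, u₂] : Fin 3 → ℝ) =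
      gnomonicWeight (![0, u₁, u₂] : Fin 3 → ℝ) * gnomonicWeight (![x₀, 0, 0] : Fin 3 → ℝ) := by
  have hc : Real.sqrt (1 + (u₁ ^ 2 + u₂ ^ 2)) ^ 2 = 1 + (u₁ ^ 2 + u₂ ^ 2) := Real.sq_sqrt (by positivity)
  simp only [gnomonicWeight, normSq3, Fin.sum_univ_three, Matrix.cons_val_zero, Matrix.cons_val_one, Matrix.cons_val_two, Matrix.head_cons, Matrix.tail_cons]
  rw [mul_pow, hc]
  have h1 : (0 : ℝ) < 1 + (u₁ ^ 2 + u₂ ^ 2) := by positivity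
  have h2 : (0 : ℝ) < 1 + x₀ ^ 2 := by positivity
  field_simp
  ring

/-- ★ **THE B-AMPLITUDE FACTORISES**: `J_B(Ψ_B(u, gnoScaleB u y)) = w(0,u₁,u₂) · g(y)` with `g(y) = ((1+y_δ²)⁻¹)²·ρ((gnoFibreBEmb y).2)` independent of the base `u`
(`J_B(δ, η) = ((1+δ²)⁻¹)²ρ(η)`, ✓`gnomonicWeight_bRescaled`). [folklore] -/
theorem bDensity_rescaled_eq (u : ℝ × ℝ) (y : GnoFibreB L) :
    ((1 + (gnoFibreBEquiv (u, gnoScaleB u y)).1 ^ 2)⁻¹) ^ 2 * gnoDensity (gnoFibreBEquiv (u, gnoScaleB u y)).2 =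
      gnomonicWeight (![0, u.1, u.2] : Fin 3 → ℝ) * (((1 + (gnoFibreBEmb y).1 ^ 2)⁻¹) ^ 2 * gnoDensity (gnoFibreBEmb y).2) := by
  rw [gnoFibreBEquiv_gnoScaleB, gnoFibreBEmb_apply]
  simp only [gnoDensity]
  rw [gnomonicWeight_bRescaled]
  ring

omit [NeZero L] in
/-- One step of the product bound: factors in `[0,1]` with `1 − α ≤ a`, `1 − β ≤ b` (`β ≥ 0`) have `1 − (α+β) ≤ ab ≤ 1`, `0 ≤ ab`. [folklore] -/
theorem bWeight_mul_step {a b α β : ℝ} (ha0 : 0 ≤ a) (ha1 : a ≤ 1) (hb0 : 0 ≤ b) (hb1 : b ≤ 1) (ha : 1 - α ≤ a) (hb : 1 - β ≤ b) (hβ : 0 ≤ β) :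
    1 - (α + β) ≤ a * b ∧ 0 ≤ a * b ∧ a * b ≤ 1 := by
  refine ⟨?_, mul_nonneg ha0 hb0, mul_le_one₀ ha1 hb0 hb1⟩
  nlinarith [mul_nonneg ha0 hb0, mul_nonneg (sub_nonneg.2 ha1) hβ, mul_nonneg hb0 (sub_nonneg.2 ha)]

/-- ★ **THE FIBRE PART OF THE B-AMPLITUDE**: `1 − 2‖y‖² ≤ g(y) ≤ 1` with `g(y) = ((1+y_δ²)⁻¹)²·ρ((gnoFibreBEmb y).2)` (five gnomonic weights, each in `[1 − 2|letter|², 1]`: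
✓`one_sub_two_mul_le_gnomonicWeight`, ✓`piWeight_ge_one_sub`). [folklore] -/
theorem bFibreWeight_bounds (y : GnoFibreB L) :
    1 - 2 * ‖y‖ ^ 2 ≤ ((1 + (gnoFibreBEmb y).1 ^ 2)⁻¹) ^ 2 * gnoDensity (gnoFibreBEmb y).2 ∧
      ((1 + (gnoFibreBEmb y).1 ^ 2)⁻¹) ^ 2 * gnoDensity (gnoFibreBEmb y).2 ≤ 1 ∧
      0 < ((1 + (gnoFibreBEmb y).1 ^ 2)⁻¹) ^ 2 * gnoDensity (gnoFibreBEmb y).2 := by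
  have hpos : 0 < ((1 + (gnoFibreBEmb y).1 ^ 2)⁻¹) ^ 2 * gnoDensity (gnoFibreBEmb y).2 := mul_pos (by positivity) (gnoDensity_pos _)
  rw [gnoFibreBEmb_apply]
  rw [gnoFibreBEmb_apply] at hpos
  simp only [gnoDensity] at hpos ⊢
  -- the δ factor is a gnomonic weight too
  have eδ : ((1 + y (Sum.inl (Sum.inl 0)) ^ 2)⁻¹) ^ 2 = gnomonicWeight (![y (Sum.inl (Sum.inl 0)), 0, 0] : Fin 3 → ℝ) := by
    simp [gnomonicWeight, normSq3, Fin.sum_univ_three]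
  rw [eδ] at hpos ⊢
  set wδ := gnomonicWeight (![y (Sum.inl (Sum.inl 0)), 0, 0] : Fin 3 → ℝ) with hwδ
  set wx := gnomonicWeight (![y (Sum.inl (Sum.inl 1)), 0, 0] : Fin 3 → ℝ) with hwx
  set wy := gnomonicWeight (![y (Sum.inl (Sum.inl 2)), y (Sum.inl (Sum.inr 0)), y (Sum.inl (Sum.inr 1))] : Fin 3 → ℝ) with hwy
  set wz := gnomonicWeight (fun k => y (Sum.inr (Sum.inl k))) with hwz
  set wF := piWeight (fun f k => y (Sum.inr (Sum.inr (f, k)))) with hwF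
  -- letter squares
  have nδ : normSq3 (![y (Sum.inl (Sum.inl 0)), 0, 0] : Fin 3 → ℝ) = y (Sum.inl (Sum.inl 0)) ^ 2 := by simp [normSq3, Fin.sum_univ_three]
  have nx : normSq3 (![y (Sum.inl (Sum.inl 1)), 0, 0] : Fin 3 → ℝ) = y (Sum.inl (Sum.inl 1)) ^ 2 := by simp [normSq3, Fin.sum_univ_three]
  have ny : normSq3 (![y (Sum.inl (Sum.inl 2)), y (Sum.inl (Sum.inr 0)), y (Sum.inl (Sum.inr 1))] : Fin 3 → ℝ) =
      y (Sum.inl (Sum.inl 2)) ^ 2 + (y (Sum.inl (Sum.inr 0)) ^ 2 + y (Sum.inl (Sum.inr 1)) ^ 2) := by simp [normSq3, Fin.sum_univ_three]; ring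
  have hδ1 := one_sub_two_mul_le_gnomonicWeight (![y (Sum.inl (Sum.inl 0)), 0, 0] : Fin 3 → ℝ)
  have hx1 := one_sub_two_mul_le_gnomonicWeight (![y (Sum.inl (Sum.inl 1)), 0, 0] : Fin 3 → ℝ)
  have hy1 := one_sub_two_mul_le_gnomonicWeight (![y (Sum.inl (Sum.inl 2)), y (Sum.inl (Sum.inr 0)), y (Sum.inl (Sum.inr 1))] : Fin 3 → ℝ)
  have hz1 := one_sub_two_mul_le_gnomonicWeight (fun k => y (Sum.inr (Sum.inl k)))
  have hF1 := piWeight_ge_one_sub (fun f k => y (Sum.inr (Sum.inr (f, k))))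
  rw [nδ, ← hwδ] at hδ1
  rw [nx, ← hwx] at hx1
  rw [ny, ← hwy] at hy1
  rw [← hwz] at hz1
  rw [← hwF] at hF1
  have hN := norm_sq_gnoFibreB_letters y
  obtain ⟨N0, hN0⟩ : ∃ r : ℝ, r = y (Sum.inl (Sum.inl 0)) ^ 2 := ⟨_, rfl⟩
  obtain ⟨N1, hN1⟩ : ∃ r : ℝ, r = y (Sum.inl (Sum.inl 1)) ^ 2 := ⟨_, rfl⟩
  obtain ⟨N2, hN2⟩ : ∃ r : ℝ, r = y (Sum.inl (Sum.inl 2)) ^ 2 + (y (Sum.inl (Sum.inr 0)) ^ 2 + y (Sum.inl (Sum.inr 1)) ^ 2) := ⟨_, rfl⟩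
  obtain ⟨N3, hN3⟩ : ∃ r : ℝ, r = normSq3 (fun k => y (Sum.inr (Sum.inl k))) := ⟨_, rfl⟩
  obtain ⟨N4, hN4⟩ : ∃ r : ℝ, r = ∑ f, normSq3 (fun k => y (Sum.inr (Sum.inr (f, k)))) := ⟨_, rfl⟩
  rw [← hN0] at hδ1; rw [← hN1] at hx1; rw [← hN2] at hy1; rw [← hN3] at hz1; rw [← hN4] at hF1
  rw [← hN0, ← hN1, ← hN2, ← hN3, ← hN4] at hN
  have h00 : 0 ≤ N0 := by rw [hN0]; exact sq_nonneg _
  have h01 : 0 ≤ N1 := by rw [hN1]; exact sq_nonneg _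
  have h02 : 0 ≤ N2 := by rw [hN2]; exact add_nonneg (sq_nonneg _) (add_nonneg (sq_nonneg _) (sq_nonneg _))
  have h03 : 0 ≤ N3 := by rw [hN3]; exact normSq3_nonneg _
  have h04 : 0 ≤ N4 := by rw [hN4]; exact Finset.sum_nonneg fun f _ => normSq3_nonneg _
  have two0 : (0 : ℝ) ≤ 2 := by norm_num
  -- multiply up
  obtain ⟨s1, p1, q1⟩ := bWeight_mul_step (gnomonicWeight_pos _).le (gnomonicWeight_le_one _) (gnomonicWeight_pos _).le (gnomonicWeight_le_one _) hx1 hy1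
    (mul_nonneg two0 h02)
  obtain ⟨s2, p2, q2⟩ := bWeight_mul_step p1 q1 (gnomonicWeight_pos _).le (gnomonicWeight_le_one _) s1 hz1 (mul_nonneg two0 h03)
  obtain ⟨s3, p3, q3⟩ := bWeight_mul_step p2 q2 (piWeight_pos _).le (piWeight_le_one _) s2 hF1 (mul_nonneg two0 h04)
  have h123 : 0 ≤ 2 * N1 + 2 * N2 + 2 * N3 + 2 * N4 := by linarith
  obtain ⟨s4, -, q4⟩ := bWeight_mul_step (gnomonicWeight_pos _).le (gnomonicWeight_le_one _) p3 q3 hδ1 s3 h123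
  refine ⟨?_, ?_, hpos⟩
  · rw [hN]; refine le_trans (le_of_eq ?_) s4; ring
  · exact q4

/-- ★ **THE B-BASE WEIGHT** `w₀(u) = w(0,u₁,u₂)·√(1+|u|²) = (1+|u|²)^{−3∕2}` (amplitude at the base times the Jacobian of the rescaling) is positive, measurable and
INTEGRABLE on `ℝ²` (Mathlib ✓`integrable_rpow_neg_one_add_norm_sq` with `r = 3 > 2 = dim`, sup norm `‖u‖² ≤ |u|²`). [folklore] -/
theorem bBaseWeight_facts :
    (∀ u : ℝ × ℝ, 0 < gnomonicWeight (![0, u.1, u.2] : Fin 3 → ℝ) * Real.sqrt (1 + (u.1 ^ 2 + u.2 ^ 2))) ∧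
      (Measurable fun u : ℝ × ℝ => gnomonicWeight (![0, u.1, u.2] : Fin 3 → ℝ) * Real.sqrt (1 + (u.1 ^ 2 + u.2 ^ 2))) ∧
      Integrable (fun u : ℝ × ℝ => gnomonicWeight (![0, u.1, u.2] : Fin 3 → ℝ) * Real.sqrt (1 + (u.1 ^ 2 + u.2 ^ 2))) := by
  have ew : ∀ u : ℝ × ℝ, gnomonicWeight (![0, u.1, u.2] : Fin 3 → ℝ) = ((1 + (u.1 ^ 2 + u.2 ^ 2))⁻¹) ^ 2 := fun u => by
    simp [gnomonicWeight, normSq3, Fin.sum_univ_three]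
  have hm : Measurable fun u : ℝ × ℝ => gnomonicWeight (![0, u.1, u.2] : Fin 3 → ℝ) * Real.sqrt (1 + (u.1 ^ 2 + u.2 ^ 2)) := by
    have e : (fun u : ℝ × ℝ => gnomonicWeight (![0, u.1, u.2] : Fin 3 → ℝ) * Real.sqrt (1 + (u.1 ^ 2 + u.2 ^ 2))) =
        fun u : ℝ × ℝ => ((1 + (u.1 ^ 2 + u.2 ^ 2))⁻¹) ^ 2 * Real.sqrt (1 + (u.1 ^ 2 + u.2 ^ 2)) := funext fun u => by rw [ew]
    rw [e]
    have h1 : Measurable fun u : ℝ × ℝ => 1 + (u.1 ^ 2 + u.2 ^ 2) := measurable_const.add ((measurable_fst.pow_const 2).add (measurable_snd.pow_const 2))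
    exact (h1.inv.pow_const 2).mul h1.sqrt
  refine ⟨fun u => mul_pos (gnomonicWeight_pos _) (Real.sqrt_pos.2 (by positivity)), hm, ?_⟩
  -- domination by `(1 + ‖u‖²)^{-3/2}`
  have hdim : (Module.finrank ℝ (ℝ × ℝ) : ℝ) < 3 := by
    rw [Module.finrank_prod, Module.finrank_self]; norm_num
  have hI := integrable_rpow_neg_one_add_norm_sq (E := ℝ × ℝ) (μ := (volume : Measure (ℝ × ℝ))) hdim
  refine hI.mono' hm.aestronglyMeasurable (Filter.Eventually.of_forall fun u => ?_)
  have hU0 : 0 ≤ u.1 ^ 2 + u.2 ^ 2 := by positivity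
  have hpos : 0 < 1 + (u.1 ^ 2 + u.2 ^ 2) := by positivity
  -- `w₀(u) = (1+|u|²)^{-3/2}`
  have e1 : gnomonicWeight (![0, u.1, u.2] : Fin 3 → ℝ) * Real.sqrt (1 + (u.1 ^ 2 + u.2 ^ 2)) = (1 + (u.1 ^ 2 + u.2 ^ 2)) ^ (-(3 : ℝ) / 2) := by
    rw [ew, Real.sqrt_eq_rpow, ← Real.rpow_neg_one, ← Real.rpow_natCast, ← Real.rpow_mul hpos.le, ← Real.rpow_add hpos]
    norm_num
  rw [Real.norm_eq_abs, abs_of_pos (mul_pos (gnomonicWeight_pos _) (Real.sqrt_pos.2 hpos)), e1]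
  -- sup norm: `‖u‖² ≤ u₁² + u₂²`
  have hn : ‖u‖ ^ 2 ≤ u.1 ^ 2 + u.2 ^ 2 := by
    have h1 : |u.1| ≤ Real.sqrt (u.1 ^ 2 + u.2 ^ 2) := Real.abs_le_sqrt (by nlinarith [sq_nonneg u.2])
    have h2 : |u.2| ≤ Real.sqrt (u.1 ^ 2 + u.2 ^ 2) := Real.abs_le_sqrt (by nlinarith [sq_nonneg u.1])
    have h3 : ‖u‖ ≤ Real.sqrt (u.1 ^ 2 + u.2 ^ 2) := by
      rw [Prod.norm_def, Real.norm_eq_abs, Real.norm_eq_abs]; exact max_le h1 h2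
    have h4 : 0 ≤ ‖u‖ := norm_nonneg _
    calc ‖u‖ ^ 2 ≤ Real.sqrt (u.1 ^ 2 + u.2 ^ 2) ^ 2 := pow_le_pow_left₀ h4 h3 2
      _ = u.1 ^ 2 + u.2 ^ 2 := Real.sq_sqrt hU0
  exact Real.rpow_le_rpow_of_nonpos (by positivity) (by linarith) (by norm_num)

end Summit.QuantumFields.YangMills.Theorems.SwapVirialDeficit.BlowUpRing

end
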